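import Summits.KontsevichZagierPeriods.KontsevichZagierPeriods.Theses.Grothendieck
import Summits.KontsevichZagierPeriods.KontsevichZagierPeriods.Theorems.GpcZeta4Eq4zeta31.Negative.Core
import Summits.KontsevichZagierPeriods.KontsevichZagierPeriods.Theorems.GpcLegendreLemniscatic.Negative.Canonical
import Summits.KontsevichZagierPeriods.KontsevichZagierPeriods.Theorems.StuffleInKZ.Negative.Core
import Summits.KontsevichZagierPeriods.KontsevichZagierPeriods.Theorems.PentagonInKZ.Negative.KernelImplies
import Literature.NumberTheory.Transcendental.KZKernelConjectureForms
import Literature.Barriers.KontsevichZagierPeriods.PeriodEqualityDecidability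
import Summits.KontsevichZagierPeriods.KontsevichZagierPeriods.Theorems.MultiplicationAccessible.Negative.Core
import Summits.KontsevichZagierPeriods.KontsevichZagierPeriods.Theorems.GrothendieckLemniscaticSectorGlue

/-!
# Disproof of `SectorComplement` (crux stmt-KontsevichZagierPeriods-11102, route Grothendieck) — findings

Standing adversary, cycle 1 (refuter-cdisprove-stmt-KontsevichZagierPeriods-11102-0, 2026-08-16).

The crux (auto-promoted 2026-08-16 from a declared, NOT CLAIMED support item):
`SectorComplement := LemniscaticSectorKernel → GpcZeta4Eq4zeta31 → KontsevichZagierPeriods` —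
the rank-0 target of the route (Conjecture 1 in kernel form on the sector ring `ℤ[K, E, π]`, `H₁`)
and the weight-4 quasi-shuffle probe (`ζ(4) = 4ζ(3,1)` inside the calculus, `H₂`) imply the summit
statement (Conjecture 1 of Kontsevich–Zagier 2001 §1.2 over the calculus `KZ.relations`).

VERDICT SO FAR: **no kill, and provably none short of a disproof of the summit.** What this file PROVES
(0 `sorry`):

* §0 read-back: `crux_iff` (`Iff.rfl`); the summit IS the kernel form
  (`summit_iff_kernel : KontsevichZagierPeriods ↔ KZKernelConjecture`, tree theorem
  `kzKernelConjecture_iff_isRational`), so the 2026-08-15 restatement `8613 → 11102`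
  (`… → KZKernelConjecture` replaced by `… → KontsevichZagierPeriods`) changed NOTHING logically:
  `crux_iff_retired`.
* §1 BOTH ANTECEDENTS ARE SUMMIT-CONSEQUENCES: `h1_of_summit` (the sector kernel is an instance of the
  kernel form), `h2_of_summit` (landed by the sibling seat: `GpcZeta4Eq4zeta31.Negative.crux_of_summit`).
* §2 CHARACTERISATION: `crux_iff_and_imp : SectorComplement ↔ (H₁ ∧ H₂ → summit)`,
  `crux_iff_iff : SectorComplement ↔ ((H₁ ∧ H₂) ↔ summit)` — the crux says exactly "the two sector
  statements together already have summit strength"; `not_crux_iff : ¬SectorComplement ↔ H₁ ∧ H₂ ∧ ¬summit`.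
  So ANY refutation of this crux consists of (a) proofs of BOTH open sector cruxes of the route (8598 via
  0280 + 8611 + 8612, and 0275) AND (b) a disproof of Conjecture 1 as formalised. Conversely the crux is
  TRUE as soon as either sector statement is false (`crux_of_not_h1`, `crux_of_not_h2`) or the summit holds
  (`crux_of_summit`): `crux_iff_or`.
* §3 LOAD-BEARING ANALYSIS: dropping `H₁` leaves `H₂ → summit` (`withoutH1_iff : … ↔ (H₂ ↔ summit)`),
  dropping `H₂` leaves `H₁ → summit` (`withoutH2_iff`), dropping both leaves the summit (`rfl`). None of the
  three is refutable here: `not_withoutH1_iff : ¬WithoutH1 ↔ H₂ ∧ ¬summit` etc. — every `_false_without_`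
  theorem would contain a disproof of the summit. `H₂` is IDLE exactly when `H₁ → H₂`
  (`crux_iff_withoutH2_of`), in particular once 0275 is proved; symmetrically for `H₁`.
* §4 THE ONLY WEAPON, as a template: `not_summit_of_separating_invariant` /
  `not_crux_of_separating_invariant` — an additive `J : FormalRep →+ A` vanishing on the four move sets with
  `J c ≠ 0` for some `c ∈ ker eval` (plus, for the crux, proofs of `H₁`, `H₂`). Soundness
  (`relations_le_ker_eval_holds`) says `eval` is such a `J` except for the last clause; no other is known
  (sibling work files Cruxes/GpcZeta4Eq4zeta31/Disproof.lean §§4–4d and Cruxes/GpcLegendreLemniscatic/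
  Disproof.lean tried graded evaluation, augmentation, dimension projection, window / corner / slab
  evaluations: each either vanishes on kernel elements or is not move-invariant).
* §4b the one CATALOGUED conditional route to `¬summit` — the decidability barrier
  (`PeriodEqualityDecidability.lean`, `KZ.not_complete_of_undecidable`) — read against the crux:
  `not_crux_of_undecidable`; its premise (an undecidability theorem for period equality) is open.
* §4c NO-GO FOR COMBINATORIAL INVARIANTS: `P_KZ = FormalRep ⧸ relations` is a `ℚ`-vector space (divisible +
  torsion-free, tree theorems in `MultiplicationAccessible/Negative/Core.lean`), so the image of every
  move-invariant is divisible (`invariant_divisible`) and every `ℤ`-valued / finite-valued / finitely-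
  generated-valued invariant vanishes (`invariant_int_apply_eq_zero`, `invariant_finite_apply_eq_zero`,
  `invariant_fg_apply_eq_zero`); "no division by integers" is no artifact
  (`saturated`).
* §5 REFUTED STRENGTHENINGS (small models + soundness): the summit WITHOUT the value hypothesis is false
  (`not_summitWithoutValueEq`: `[ℝ⁰, 0]` vs `[ℝ⁰, 1]`), hence the crux with that strengthened conclusion is
  equivalent to `¬(H₁ ∧ H₂)` (`cruxStrong_iff`) — refuting IT is proving both sectors; the kernel form
  WITHOUT `eval c = 0` is false (`not_kernelWithoutEval`); the two `IsRational` hypotheses of the summit are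
  provably idle (`summitWithoutIsRational_iff`, tree theorem `kzPeriodConjecture'_iff_isRational`).
* §6 SUMMIT STRENGTH made concrete: given `H₁`, `H₂`, the crux proves every other open crux of the problem
  that is a summit-consequence — e.g. this route's own rank-5 crux 0280 (`gpcLegendre_of_crux`) and route
  FurushoPentagon's `StuffleInKZ`, `PentagonInKZ` (`stuffle_of_crux`, `pentagon_of_crux`). No information
  flows from the sectors INTO the complement: the complement returns everything.
  TRANSFER FORM (8612 proved in the tree 2026-08-16): `summit_of_crux_of_transfers` — crux + Chudnovsky
  (8611) + the two SINGLE identities 0280, 0275 ⟹ Conjecture 1 for all periods; `crux_iff_transfer_form`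
  (modulo the converse plumbing `H₁ → 0280`).
* §6b NEW POSITIVE LEMMA (attached as evidence, a prover may land it): `gpcLegendre_of_h1 :
  LemniscaticSectorKernel → GpcLegendreLemniscatic` (the sector kernel at the single instance
  `4[m₁₁₀] − 2[m₂₀₀] − [m₀₀₁]`, then torsion-freeness); hence `h1_iff_gpcLegendre (8611) : H₁ ↔ 0280`,
  `crux_iff_transfer_form' (8611) : crux ↔ (0280 → 0275 → summit)`, `crux_iff_withoutH2_iff' (8611) :
  (H₂ idle) ↔ (0280 → 0275)`.

WHY IT RESISTS (for the provers — and why nobody should claim it). The item is honestly labelled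
summit-strength: modulo its antecedents it is literally `KontsevichZagierPeriods` (`crux_iff_summit_of`).
A disproof needs `¬KontsevichZagierPeriods`, i.e. (by `summit_iff_kernel`) an element of `ker KZ.eval`
outside `KZ.relations`, certified by a new additive invariant of the four-move calculus. Artifact hunt on
the formal summit (this cycle, NOTES.md §Artifact hunt): dimension-0 representations (values are real
algebraic numbers; `Aut(ℝ_alg/ℚ)` is trivial, so no Galois-twisted evaluation), null / empty domains
(already relations), off-domain integrand values (irrelevant by integrand additivity), unbounded domains
(`x ↦ x/√(1+x²)` is a semialgebraic change of variables), the semialgebraic-primitive restriction of rule 3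
(barrier `noSemialgebraicPrimitive_inv_sub_two`: evaded in every worked example by Fubini order / extra
variables; Huber–Müller-Stach leave the naive-versus-motivic gap open only in the abstract) — none yields
a separating invariant. Print offers no separating example either: the rules form is expected to be
"essentially equivalent" to Grothendieck's conjecture (Huber–Wüstholz 2022, Prologue, PDF p. 11; Rem. 13.2
(2)–(3), PDF p. 121: Kontsevich's original formulation differs from Conj. 13.1 only "at a close look",
cf. [HMS17, Rem. 13.1.8], and is equivalent to a Grothendieck-style version, [HMS17, §13.2]); Ayoub's
reformulation "with fewer generators — only polydisks are needed as domains of integration" carries a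
PROVED function-field analogue (ibid., Prologue, PDF p. 13; Ayoub, Ann. of Math. 181 (2015)). So a
disproof of the H21 summit would most plausibly have to exploit a gap between the H21 top-degree real
semialgebraic calculus and Kontsevich's/Ayoub's presentations — and §4c shows the first such suspected gap
(integrality) is not one. A proof, on the other hand, is a proof of Conjecture 1 off the two sectors.
(Literature services this cycle: searchd unavailable, galaxy 0 rows — `search-degraded`; the quotes above
are from the held text book:huber2022-transcendence-linear-relations-1-periods.)

BARRIERS (`Literature/Barriers/KontsevichZagierPeriods/`): all three `kzConjecture_implies_*` dependence
barriers (elliptic periods, odd zeta values, `2πi`/`log`) have exactly this item's strength — they are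
CONSEQUENCES of the summit, hence of `H₁ ∧ H₂ ∧ SectorComplement`; none is a refutation.
`ledger negatives --problem KontsevichZagierPeriods`: KinematicPlaneConvex only (unrelated).

LANDED: see NOTES.md / HANDOFF (Negative/Core.lean proposal). Targets (lead's stuck stubs): none (`targets = []`).
-/

noncomputable section

set_option linter.dupNamespace false

namespace Summit.KontsevichZagierPeriods.KontsevichZagierPeriods.Cruxes.SectorComplement.Disproof

open Set MeasureTheory
open Literature.NumberTheory.Transcendental
open Literature.NumberTheory.Transcendental.KZ
open Literature.ModelTheory.ExponentialFields (isSemialgebraic_univ)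
open Summit.KontsevichZagierPeriods.KontsevichZagierPeriods.Theses.Grothendieck
  (SectorComplement LemniscaticSectorKernel GpcZeta4Eq4zeta31 GpcLegendreLemniscatic KEAlgIndependent
    LemniscaticSectorGlue)
open Summit.KontsevichZagierPeriods.KontsevichZagierPeriods.Theses.FurushoPentagon (StuffleInKZ PentagonInKZ)
open Summit.KontsevichZagierPeriods.MultiplicationAccessible.Negative
  (sub_nsmul_scale_inv_mem_relations mem_relations_of_nsmul_mem_relations isAlgebraic_inv_nat)
open MvPolynomial (aeval X C)
open Summit.KontsevichZagierPeriods.Grothendieck.GpcLegendreLemniscaticNegative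
  (kRep eRep gRep arctanRep legendreRep gpcLegendre_iff)
open Summit.KontsevichZagierPeriods.Grothendieck.LemniscaticSectorGlue

/-! ## §0 Read-back -/

/-- The crux unfolds definitionally to the implication chain. [folklore] -/
theorem crux_iff :
    SectorComplement ↔ (LemniscaticSectorKernel → GpcZeta4Eq4zeta31 → KontsevichZagierPeriods) :=
  Iff.rfl

/-- The summit IS the kernel form `ker eval = relations` (tree theorem
`kzKernelConjecture_iff_isRational`, whose right-hand side is verbatim the summit body). [folklore] -/
theorem summit_iff_kernel : KontsevichZagierPeriods ↔ KZKernelConjecture :=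
  kzKernelConjecture_iff_isRational.symm

/-- The retired form of the item (stmt-8613: `… → KZKernelConjecture`) is logically identical to the
current one (stmt-11102: `… → KontsevichZagierPeriods`). [folklore] -/
theorem crux_iff_retired :
    SectorComplement ↔ (LemniscaticSectorKernel → GpcZeta4Eq4zeta31 → KZKernelConjecture) := by
  rw [crux_iff, summit_iff_kernel]

/-! ## §1 Both antecedents are consequences of the summit -/

/-- `H₁` from the kernel form: the sector kernel statement is an instance of `ker eval ≤ relations`
(its domain / integrand hypotheses are not even used). [folklore] -/
theorem h1_of_kernel (h : KZKernelConjecture) : LemniscaticSectorKernel := by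
  intro ι _ z a b c r _ _ h0
  exact h _ h0

/-- `H₁` from the summit. [folklore] -/
theorem h1_of_summit (h : KontsevichZagierPeriods) : LemniscaticSectorKernel :=
  h1_of_kernel (summit_iff_kernel.mp h)

/-- `H₂` from the summit (sibling seat, landed: `GpcZeta4Eq4zeta31.Negative.crux_of_summit`). [folklore] -/
theorem h2_of_summit (h : KontsevichZagierPeriods) : GpcZeta4Eq4zeta31 :=
  Summit.KontsevichZagierPeriods.GpcZeta4Eq4zeta31.Negative.crux_of_summit h

/-- Both antecedents from the summit. [folklore] -/
theorem antecedents_of_summit (h : KontsevichZagierPeriods) :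
    LemniscaticSectorKernel ∧ GpcZeta4Eq4zeta31 :=
  ⟨h1_of_summit h, h2_of_summit h⟩

/-! ## §2 Characterisation -/

/-- The summit proves the crux (trivially: discard the antecedents). [folklore] -/
theorem crux_of_summit (h : KontsevichZagierPeriods) : SectorComplement := fun _ _ => h

/-- Uncurried form. [folklore] -/
theorem crux_iff_and_imp :
    SectorComplement ↔ (LemniscaticSectorKernel ∧ GpcZeta4Eq4zeta31 → KontsevichZagierPeriods) :=
  ⟨fun h hx => h hx.1 hx.2, fun h h1 h2 => h ⟨h1, h2⟩⟩

/-- **The crux says exactly: the two sector statements together are summit-strength.** [folklore] -/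
theorem crux_iff_iff :
    SectorComplement ↔ ((LemniscaticSectorKernel ∧ GpcZeta4Eq4zeta31) ↔ KontsevichZagierPeriods) :=
  ⟨fun h => ⟨crux_iff_and_imp.mp h, antecedents_of_summit⟩, fun h => crux_iff_and_imp.mpr h.mp⟩

/-- Modulo its antecedents the crux IS the summit. [folklore] -/
theorem crux_iff_summit_of (h1 : LemniscaticSectorKernel) (h2 : GpcZeta4Eq4zeta31) :
    SectorComplement ↔ KontsevichZagierPeriods :=
  ⟨fun h => h h1 h2, crux_of_summit⟩

/-- **Anatomy of a refutation**: `¬ crux` is precisely "both sectors proved AND the summit refuted". [folklore] -/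
theorem not_crux_iff :
    ¬ SectorComplement ↔ (LemniscaticSectorKernel ∧ GpcZeta4Eq4zeta31 ∧ ¬ KontsevichZagierPeriods) := by
  rw [crux_iff]
  constructor
  · intro h
    by_contra hc
    exact h fun h1 h2 => Classical.by_contradiction fun hs => hc ⟨h1, h2, hs⟩
  · rintro ⟨h1, h2, hs⟩ h
    exact hs (h h1 h2)

/-- A refutation of the crux refutes the summit. [folklore] -/
theorem not_summit_of_not_crux (h : ¬ SectorComplement) : ¬ KontsevichZagierPeriods :=
  (not_crux_iff.mp h).2.2

/-- A refutation of the crux proves the route's rank-0 target. [folklore] -/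
theorem h1_of_not_crux (h : ¬ SectorComplement) : LemniscaticSectorKernel :=
  (not_crux_iff.mp h).1

/-- A refutation of the crux proves the weight-4 probe 0275. [folklore] -/
theorem h2_of_not_crux (h : ¬ SectorComplement) : GpcZeta4Eq4zeta31 :=
  (not_crux_iff.mp h).2.1

/-- The crux holds vacuously if the sector kernel fails. [folklore] -/
theorem crux_of_not_h1 (h : ¬ LemniscaticSectorKernel) : SectorComplement := fun h1 _ => absurd h1 h

/-- The crux holds vacuously if the weight-4 probe fails. [folklore] -/
theorem crux_of_not_h2 (h : ¬ GpcZeta4Eq4zeta31) : SectorComplement := fun _ h2 => absurd h2 h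

/-- Classical trichotomy. [folklore] -/
theorem crux_iff_or :
    SectorComplement ↔ (KontsevichZagierPeriods ∨ ¬ LemniscaticSectorKernel ∨ ¬ GpcZeta4Eq4zeta31) := by
  constructor
  · intro h
    by_cases h1 : LemniscaticSectorKernel
    · by_cases h2 : GpcZeta4Eq4zeta31
      · exact Or.inl (h h1 h2)
      · exact Or.inr (Or.inr h2)
    · exact Or.inr (Or.inl h1)
  · rintro (h | h | h)
    exacts [crux_of_summit h, crux_of_not_h1 h, crux_of_not_h2 h]

/-! ## §3 Load-bearing analysis: dropping hypotheses -/

/-- The crux with `H₁` dropped (a route-item VARIANT named for the load-bearing analysis, not a cited fact). -/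
def WithoutH1 : Prop := GpcZeta4Eq4zeta31 → KontsevichZagierPeriods

/-- The crux with `H₂` dropped (a route-item VARIANT, not a cited fact). -/
def WithoutH2 : Prop := LemniscaticSectorKernel → KontsevichZagierPeriods

/-- The crux with both antecedents dropped: the summit itself (a route-item VARIANT, not a cited fact). -/
def WithoutBoth : Prop := KontsevichZagierPeriods

/-- Dropping `H₁` leaves "`H₂` is summit-strength". [folklore] -/
theorem withoutH1_iff : WithoutH1 ↔ (GpcZeta4Eq4zeta31 ↔ KontsevichZagierPeriods) :=
  ⟨fun h => ⟨h, h2_of_summit⟩, fun h => h.mp⟩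

/-- Dropping `H₂` leaves "`H₁` is summit-strength". [folklore] -/
theorem withoutH2_iff : WithoutH2 ↔ (LemniscaticSectorKernel ↔ KontsevichZagierPeriods) :=
  ⟨fun h => ⟨h, h1_of_summit⟩, fun h => h.mp⟩

/-- Dropping both leaves the summit. [folklore] -/
theorem withoutBoth_iff : WithoutBoth ↔ KontsevichZagierPeriods := Iff.rfl

/-- Each weakened form implies the crux. [folklore] -/
theorem crux_of_withoutH1 (h : WithoutH1) : SectorComplement := fun _ h2 => h h2

/-- Each weakened form implies the crux. [folklore] -/
theorem crux_of_withoutH2 (h : WithoutH2) : SectorComplement := fun h1 _ => h h1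

/-- None of the weakened forms is refutable short of a disproof of the summit. [folklore] -/
theorem not_withoutH1_iff : ¬ WithoutH1 ↔ (GpcZeta4Eq4zeta31 ∧ ¬ KontsevichZagierPeriods) := by
  unfold WithoutH1; constructor
  · intro h; by_contra hc; exact h fun h2 => Classical.by_contradiction fun hs => hc ⟨h2, hs⟩
  · rintro ⟨h2, hs⟩ h; exact hs (h h2)

/-- None of the weakened forms is refutable short of a disproof of the summit. [folklore] -/
theorem not_withoutH2_iff : ¬ WithoutH2 ↔ (LemniscaticSectorKernel ∧ ¬ KontsevichZagierPeriods) := by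
  unfold WithoutH2; constructor
  · intro h; by_contra hc; exact h fun h1 => Classical.by_contradiction fun hs => hc ⟨h1, hs⟩
  · rintro ⟨h1, hs⟩ h; exact hs (h h1)

/-- `H₂` is IDLE (the crux with or without it is the same statement) exactly when `H₁ → H₂` — in
particular once 0275 is proved, or if the sector kernel implied the weight-4 probe. [folklore] -/
theorem crux_iff_withoutH2_of (h12 : LemniscaticSectorKernel → GpcZeta4Eq4zeta31) :
    SectorComplement ↔ WithoutH2 :=
  ⟨fun h h1 => h h1 (h12 h1), crux_of_withoutH2⟩

/-- Symmetrically `H₁` is idle exactly when `H₂ → H₁`. [folklore] -/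
theorem crux_iff_withoutH1_of (h21 : GpcZeta4Eq4zeta31 → LemniscaticSectorKernel) :
    SectorComplement ↔ WithoutH1 :=
  ⟨fun h h2 => h (h21 h2) h2, crux_of_withoutH1⟩

/-- EXACT IDLENESS CRITERION: `H₂` is idle in the crux if and only if `H₁ → H₂` (idleness is a genuine
condition, not a tautology: in the scenario `H₁ ∧ ¬H₂ ∧ ¬summit` the crux holds and `WithoutH2` fails). [folklore] -/
theorem crux_iff_withoutH2_iff :
    (SectorComplement ↔ WithoutH2) ↔ (LemniscaticSectorKernel → GpcZeta4Eq4zeta31) := by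
  refine ⟨fun hidle h1 => ?_, crux_iff_withoutH2_of⟩
  by_cases h2 : GpcZeta4Eq4zeta31
  · exact h2
  · exact h2_of_summit (hidle.mp (crux_of_not_h2 h2) h1)

/-- Symmetrically `H₁` is idle if and only if `H₂ → H₁`. [folklore] -/
theorem crux_iff_withoutH1_iff :
    (SectorComplement ↔ WithoutH1) ↔ (GpcZeta4Eq4zeta31 → LemniscaticSectorKernel) := by
  refine ⟨fun hidle h2 => ?_, crux_iff_withoutH1_of⟩
  by_cases h1 : LemniscaticSectorKernel
  · exact h1
  · exact h1_of_summit (hidle.mp (crux_of_not_h1 h1) h2)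

/-! ## §4 The only weapon: a separating additive invariant (template) -/

/-- TEMPLATE of a disproof of the summit: an additive invariant `J` of `FormalRep` vanishing on the four
move sets together with a formal combination of value `0` on which `J` does not vanish. (Soundness,
`relations_le_ker_eval_holds`, says `eval` is such a `J` except for the last clause.) [folklore] -/
theorem not_summit_of_separating_invariant {A : Type*} [AddCommGroup A] (J : FormalRep →+ A)
    (hJ : ∀ x ∈ domainAddRel ∪ integrandAddRel ∪ changeOfVariablesRel ∪ newtonLeibnizRel, J x = 0)
    (c : FormalRep) (hc : eval c = 0) (hJc : J c ≠ 0) : ¬ KontsevichZagierPeriods := fun h => by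
  have hker : relations ≤ J.ker := (AddSubgroup.closure_le _).mpr fun x hx => hJ x hx
  exact hJc (hker (summit_iff_kernel.mp h c hc))

/-- TEMPLATE of a refutation of the crux: the same invariant PLUS proofs of both sector statements. [folklore] -/
theorem not_crux_of_separating_invariant {A : Type*} [AddCommGroup A] (J : FormalRep →+ A)
    (hJ : ∀ x ∈ domainAddRel ∪ integrandAddRel ∪ changeOfVariablesRel ∪ newtonLeibnizRel, J x = 0)
    (c : FormalRep) (hc : eval c = 0) (hJc : J c ≠ 0)
    (h1 : LemniscaticSectorKernel) (h2 : GpcZeta4Eq4zeta31) : ¬ SectorComplement :=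
  not_crux_iff.mpr ⟨h1, h2, not_summit_of_separating_invariant J hJ c hc hJc⟩

/-- Conversely every refutation of the summit IS such a pair `(J, c)`: take `J` the quotient map by
`relations` (valued in `FormalRep ⧸ relations`) and `c` the non-relation of value `0`. [folklore] -/
theorem exists_separating_of_not_summit (h : ¬ KontsevichZagierPeriods) :
    ∃ c : FormalRep, eval c = 0 ∧ c ∉ relations := by
  rw [summit_iff_kernel] at h
  unfold KZKernelConjecture at h
  push Not at h
  exact h

/-! ## §4b The one CATALOGUED conditional route to `¬ summit`: undecidability of period equality

`Literature/Barriers/KontsevichZagierPeriods/PeriodEqualityDecidability.lean`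
(`KZ.not_complete_of_undecidable`): an undecidability theorem for equality of periods in a coding of
rational representations with uniformly computable values on which `KZ.Equivalent` is r.e. would refute
the summit — hence, with the two sectors, this crux. Its premise is open (Problem 1 of KZ 2001 §1.2;
no undecidability theorem for period equality is known, and the conjecture itself predicts
decidability), so this is a template, not an attack. -/

/-- The decidability barrier read against the crux. [folklore] -/
theorem not_crux_of_undecidable {ι : Type*} [Primcodable ι]
    (code : ι → Σ n, IntegralRep n) (hrat : ∀ i, (code i).2.IsRational)
    (hcomp : Literature.Barriers.KontsevichZagierPeriods.UniformlyComputable fun i => (code i).2.value)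
    (hre : REPred fun p : ι × ι => Equivalent (code p.1).2 (code p.2).2)
    (hU : ¬ Literature.Barriers.KontsevichZagierPeriods.DecidableEquality fun i => (code i).2.value)
    (h1 : LemniscaticSectorKernel) (h2 : GpcZeta4Eq4zeta31) : ¬ SectorComplement :=
  not_crux_iff.mpr ⟨h1, h2,
    Literature.Barriers.KontsevichZagierPeriods.KZ.not_complete_of_undecidable code hrat hcomp hre hU⟩

/-! ## §4c No-go for "combinatorial" invariants: the image of every move-invariant is divisible

`P_KZ = FormalRep ⧸ relations` is divisible (`[r] ≡ m • scale(1/m)[r]`: one scaling change of variables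
and integrand additivity — tree: `sub_nsmul_scale_inv_mem_relations`) and torsion-free (tree:
`mem_relations_of_nsmul_mem_relations`, both in `Theorems/MultiplicationAccessible/Negative/Core.lean`),
i.e. a `ℚ`-vector space. Hence the separating invariant `J` of §4 may be taken `ℚ`-linear, and every
`ℤ`-valued or finite-valued move-invariant (counting, parity, Euler characteristic with integer
structure, …) vanishes identically: such invariants can never refute the summit or this crux. In
particular the worry "the calculus cannot divide by integers" (summit docstring: "no division by
integers is a rule") produces no artifact: `2·d ∈ relations ⇒ d ∈ relations`. -/

/-- The image of a move-invariant is a divisible subgroup. [folklore] -/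
theorem invariant_divisible {A : Type*} [AddCommGroup A] (J : FormalRep →+ A) (hJ : relations ≤ J.ker)
    (c : FormalRep) {m : ℕ} (hm : m ≠ 0) : ∃ c' : FormalRep, J c = m • J c' := by
  refine ⟨scale ((m : ℝ)⁻¹) (isAlgebraic_inv_nat m) c, ?_⟩
  have h := hJ (sub_nsmul_scale_inv_mem_relations hm c)
  rwa [AddMonoidHom.mem_ker, map_sub, map_nsmul, sub_eq_zero] at h

/-- Move-invariance on generators of `relations` is the same as `relations ≤ ker J`. [folklore] -/
theorem relations_le_ker_of_moves {A : Type*} [AddCommGroup A] (J : FormalRep →+ A)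
    (hJ : ∀ x ∈ domainAddRel ∪ integrandAddRel ∪ changeOfVariablesRel ∪ newtonLeibnizRel, J x = 0) :
    relations ≤ J.ker :=
  (AddSubgroup.closure_le _).mpr fun x hx => hJ x hx

/-- **No `ℤ`-valued move-invariant.** [folklore] -/
theorem invariant_int_apply_eq_zero (J : FormalRep →+ ℤ) (hJ : relations ≤ J.ker) (c : FormalRep) :
    J c = 0 := by
  obtain ⟨c', h⟩ := invariant_divisible J hJ c (Nat.succ_ne_zero (J c).natAbs)
  rw [nsmul_eq_mul] at h
  refine Int.eq_zero_of_dvd_of_natAbs_lt_natAbs ⟨J c', h⟩ ?_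
  rw [Int.natAbs_natCast]
  exact Nat.lt_succ_self _

/-- **No finite-valued move-invariant** (parities, residues, …). [folklore] -/
theorem invariant_finite_apply_eq_zero {A : Type*} [AddCommGroup A] [Finite A] (J : FormalRep →+ A)
    (hJ : relations ≤ J.ker) (c : FormalRep) : J c = 0 := by
  have hcard : Nat.card A ≠ 0 := Nat.card_pos.ne'
  obtain ⟨c', h⟩ := invariant_divisible J hJ c hcard
  rw [h]
  exact addOrderOf_dvd_iff_nsmul_eq_zero.mp (addOrderOf_dvd_natCard (J c'))

/-- Composition with any additive map preserves move-invariance. [folklore] -/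
theorem invariant_comp_le {A B : Type*} [AddCommGroup A] [AddCommGroup B] (g : A →+ B)
    (J : FormalRep →+ A) (hJ : relations ≤ J.ker) : relations ≤ (g.comp J).ker := fun x hx => by
  rw [AddMonoidHom.mem_ker, AddMonoidHom.comp_apply, (AddMonoidHom.mem_ker).mp (hJ hx), map_zero]

/-- **No move-invariant with finitely generated values** (structure theorem `A ≃ ℤⁿ × ⨁ ℤ/pᵢ^{eᵢ}`:
the free coordinates are `ℤ`-valued invariants, the torsion coordinates finite-valued ones). A
separating invariant, if any, lives in a non-finitely-generated group (`ℝ`, a `ℚ`-vector space,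
`ℝ ⊗ ℝ/2πℚ`, …). [folklore] -/
theorem invariant_fg_apply_eq_zero {A : Type*} [AddCommGroup A] [AddGroup.FG A] (J : FormalRep →+ A)
    (hJ : relations ≤ J.ker) (c : FormalRep) : J c = 0 := by
  obtain ⟨n, ι, _, p, hp, e, ⟨f⟩⟩ := AddCommGroup.equiv_free_prod_directSum_zmod A
  have hJ' : relations ≤ (f.toAddMonoidHom.comp J).ker := invariant_comp_le f.toAddMonoidHom J hJ
  have h1 : ∀ k : Fin n, (f (J c)).1 k = 0 := fun k =>
    invariant_int_apply_eq_zero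
      (((Finsupp.applyAddHom k).comp (AddMonoidHom.fst (Fin n →₀ ℤ) (DirectSum ι fun i => ZMod (p i ^ e i)))).comp
        (f.toAddMonoidHom.comp J))
      (invariant_comp_le _ (f.toAddMonoidHom.comp J) hJ') c
  have h2 : ∀ i : ι, DirectSum.component ℤ ι (fun i => ZMod (p i ^ e i)) i (f (J c)).2 = 0 := fun i => by
    haveI : NeZero (p i ^ e i) := ⟨pow_ne_zero _ (hp i).ne_zero⟩
    exact invariant_finite_apply_eq_zero
      (((DirectSum.component ℤ ι (fun i => ZMod (p i ^ e i)) i).toAddMonoidHom.comp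
        (AddMonoidHom.snd (Fin n →₀ ℤ) (DirectSum ι fun i => ZMod (p i ^ e i)))).comp
        (f.toAddMonoidHom.comp J))
      (invariant_comp_le _ (f.toAddMonoidHom.comp J) hJ') c
  have key : f (J c) = 0 :=
    Prod.ext (Finsupp.ext h1) (DirectSum.ext_component ℤ fun i => (h2 i).trans (map_zero _).symm)
  exact f.injective (key.trans (map_zero f).symm)

/-- Torsion-freeness read against the crux: a refutation "only `m·c` is derivable" is impossible —
if `H₁`, `H₂` and the crux give `m • c ∈ relations` then `c ∈ relations` already (tree theorem). [folklore] -/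
theorem saturated {m : ℕ} (hm : m ≠ 0) {c : FormalRep} (h : m • c ∈ relations) : c ∈ relations :=
  mem_relations_of_nsmul_mem_relations hm h

/-! ## §5 Refuted strengthenings (small models, soundness) -/

/-- The constant representation `∫_{ℝ⁰} 0 / 1` (value `0`, KZ-literal shape; a witness, not a cited fact). -/
def zeroRep0 : IntegralRep 0 :=
  IntegralRep.ofRational univ 0 1 isSemialgebraic_univ (fun _ _ => by simp) (by simp)

/-- The constant representation `∫_{ℝ⁰} 1 / 1` (value `1`, KZ-literal shape; a witness, not a cited fact). -/
def oneRep0 : IntegralRep 0 :=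
  IntegralRep.ofRational univ 1 1 isSemialgebraic_univ (fun _ _ => by simp) (by simp)

theorem zeroRep0_value : zeroRep0.value = 0 := by
  simp [zeroRep0, IntegralRep.value_ofRational]

theorem oneRep0_value : oneRep0.value = 1 := by
  simp only [oneRep0, IntegralRep.value_ofRational]
  simp [MeasureTheory.Measure.real, MeasureTheory.volume_pi]

theorem zeroRep0_isRational : zeroRep0.IsRational := IntegralRep.isRational_ofRational _ _ _ _ _ _

theorem oneRep0_isRational : oneRep0.IsRational := IntegralRep.isRational_ofRational _ _ _ _ _ _

/-- `[ℝ⁰, 0]` and `[ℝ⁰, 1]` are not equivalent (soundness). [folklore] -/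
theorem not_equivalent_zero_one : ¬ Equivalent zeroRep0 oneRep0 := fun h => by
  have := Equivalent.value_eq_holds h
  rw [zeroRep0_value, oneRep0_value] at this
  exact zero_ne_one this

/-- STRENGTHENING 1: the summit without its value hypothesis (a VARIANT of the summit statement, refuted
below; not a cited fact). -/
def SummitWithoutValueEq : Prop :=
  ∀ ⦃n m : ℕ⦄ (r : IntegralRep n) (r' : IntegralRep m), r.IsRational → r'.IsRational → Equivalent r r'

/-- … is false: any proof of the summit must use `r.value = r'.value`. [folklore] -/
theorem not_summitWithoutValueEq : ¬ SummitWithoutValueEq := fun h =>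
  not_equivalent_zero_one (h zeroRep0 oneRep0 zeroRep0_isRational oneRep0_isRational)

/-- The crux with the strengthened conclusion (a route-item VARIANT, not a cited fact). -/
def CruxStrong : Prop := LemniscaticSectorKernel → GpcZeta4Eq4zeta31 → SummitWithoutValueEq

/-- … is equivalent to the failure of a sector: refuting IT means proving both sector cruxes. [folklore] -/
theorem cruxStrong_iff : CruxStrong ↔ ¬ (LemniscaticSectorKernel ∧ GpcZeta4Eq4zeta31) :=
  ⟨fun h hx => not_summitWithoutValueEq (h hx.1 hx.2), fun h h1 h2 => absurd ⟨h1, h2⟩ h⟩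

/-- STRENGTHENING 2: the kernel form without `eval c = 0` (a VARIANT, refuted below; not a cited fact). -/
def KernelWithoutEval : Prop := ∀ c : FormalRep, c ∈ relations

/-- … is false (`[ℝ⁰, 1]` has value `1`). [folklore] -/
theorem not_kernelWithoutEval : ¬ KernelWithoutEval := fun h => by
  have h0 : eval (of oneRep0) = 0 := relations_le_ker_eval_holds (h (of oneRep0))
  rw [eval_of, oneRep0_value] at h0
  exact one_ne_zero h0

/-- STRENGTHENING 3 (not a strengthening in truth value): the two `IsRational` hypotheses of the summit
are idle — the summit for ALL representations with `ℚ`-semialgebraic data is equivalent to the summit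
(tree theorem `kzPeriodConjecture'_iff_isRational`). [folklore] -/
theorem summitWithoutIsRational_iff : KZPeriodConjecture' ↔ KontsevichZagierPeriods :=
  kzPeriodConjecture'_iff_isRational

/-! ## §6 Summit strength made concrete: the complement returns every other crux -/

/-- Given the two sectors, the crux proves this route's own rank-5 crux 0280 (Legendre's relation in the
calculus) — via the summit (sibling seat, landed: `not_kontsevichZagierPeriods_of_not_gpcLegendre`). [folklore] -/
theorem gpcLegendre_of_crux (h : SectorComplement) (h1 : LemniscaticSectorKernel) (h2 : GpcZeta4Eq4zeta31) :
    GpcLegendreLemniscatic := by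
  by_contra hneg
  exact Summit.KontsevichZagierPeriods.Grothendieck.GpcLegendreLemniscaticNegative.not_kontsevichZagierPeriods_of_not_gpcLegendre
    hneg (h h1 h2)

/-- … and route FurushoPentagon's crux `StuffleInKZ` (landed: `StuffleInKZ.Negative.stuffleInKZ_of_summit`). [folklore] -/
theorem stuffle_of_crux (h : SectorComplement) (h1 : LemniscaticSectorKernel) (h2 : GpcZeta4Eq4zeta31) :
    StuffleInKZ :=
  Summit.KontsevichZagierPeriods.Theorems.StuffleInKZ.Negative.stuffleInKZ_of_summit (h h1 h2)

/-- … and route FurushoPentagon's crux `PentagonInKZ` (landed: `pentagonInKZ_of_summit`). [folklore] -/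
theorem pentagon_of_crux (h : SectorComplement) (h1 : LemniscaticSectorKernel) (h2 : GpcZeta4Eq4zeta31) :
    PentagonInKZ :=
  Summit.KontsevichZagierPeriods.FurushoPentagon.PentagonInKZNegative.pentagonInKZ_of_summit (h h1 h2)

/-- TRANSFER FORM (uses 8612 `LemniscaticSectorGlue`, PROVED in the tree 2026-08-16,
`lemniscaticSectorGlue_proof`): given the crux and Chudnovsky's independence (8611), the two SINGLE
move-derivable identities of the route — Legendre's relation at `k² = 1/2` (0280) and `ζ(4) = 4ζ(3,1)`
(0275) — already imply Conjecture 1 for ALL periods. This is the crux's real content, visibly of summit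
strength. [folklore] -/
theorem summit_of_crux_of_transfers (h : SectorComplement) (hk : KEAlgIndependent)
    (h0280 : GpcLegendreLemniscatic) (h0275 : GpcZeta4Eq4zeta31) : KontsevichZagierPeriods :=
  h (Summit.KontsevichZagierPeriods.Grothendieck.LemniscaticSectorGlue.lemniscaticSectorGlue_proof hk h0280)
    h0275

/-- … and conversely, modulo the (mathematically clear, not yet formalised) converse plumbing
`H₁ → 0280` (from `H₁`: `2·d₀₂₈₀ ∈ relations` by the instance `4[m₁₁₀] − 2[m₂₀₀] − [m₀₀₁]`, then
torsion-freeness §4c), the crux IS the transfer form. [folklore] -/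
theorem crux_iff_transfer_form (hk : KEAlgIndependent)
    (h10280 : LemniscaticSectorKernel → GpcLegendreLemniscatic) :
    SectorComplement ↔ (GpcLegendreLemniscatic → GpcZeta4Eq4zeta31 → KontsevichZagierPeriods) :=
  ⟨fun h h0280 h0275 => summit_of_crux_of_transfers h hk h0280 h0275,
    fun h h1 h2 => h (h10280 h1) h2⟩

/-! ## §6b The converse plumbing `H₁ → 0280` (NEW, proved here): the target IS the rank-5 crux -/

/-- `ψ(L) = 4κε − 2κ² − ϖ = 0` in the formal period ring `FormalRep ⧸ relations`, from the sector
kernel `H₁` applied to the SINGLE instance `4[m₁₁₀] − 2[m₂₀₀] − [m₀₀₁]` (value `4KE − 2K² − π = 0`,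
Legendre; monomial representations from `exists_monoRep` of the glue file). [folklore] -/
theorem aeval_formalPeriod_legendre_of_h1 (h1 : LemniscaticSectorKernel) (p : IntegralRep 1)
    (hpd : p.domain = univ) (hpi : p.integrand = fun x => 1 / (1 + x 0 ^ 2)) :
    aeval ![toFormalPeriod (of kRep), toFormalPeriod (of eRep), toFormalPeriod (of p)]
      (4 * X 0 * X 1 - 2 * X 0 ^ 2 - X 2 : MvPolynomial (Fin 3) ℤ) = 0 := by
  let a : Fin 3 → ℕ := ![1, 2, 0]
  let b : Fin 3 → ℕ := ![1, 0, 0]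
  let c : Fin 3 → ℕ := ![0, 0, 1]
  let z : Fin 3 → ℤ := ![4, -2, -1]
  choose m hmd hmi hmP using fun i => exists_monoRep p hpd hpi (a i) (b i) (c i)
  have hpoly : (∑ i, z i • (X 0 ^ a i * X 1 ^ b i * X 2 ^ c i : MvPolynomial (Fin 3) ℤ)) =
      4 * X 0 * X 1 - 2 * X 0 ^ 2 - X 2 := by
    simp only [Fin.sum_univ_three, a, b, c, z, Matrix.cons_val_zero, Matrix.cons_val_one,
      Matrix.head_cons, Matrix.cons_val_two, Matrix.tail_cons]
    simp only [zsmul_eq_mul, Int.cast_ofNat, Int.cast_neg, Int.cast_one, pow_zero, pow_one, mul_one]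
    ring
  have hS : toFormalPeriod (∑ i, z i • of (m i)) =
      aeval ![toFormalPeriod (of kRep), toFormalPeriod (of eRep), toFormalPeriod (of p)]
        (∑ i, z i • (X 0 ^ a i * X 1 ^ b i * X 2 ^ c i : MvPolynomial (Fin 3) ℤ)) := by
    rw [map_sum, map_sum]
    refine Finset.sum_congr rfl fun i _ => ?_
    rw [map_zsmul, map_zsmul, hmP]
    simp only [map_mul, map_pow, MvPolynomial.aeval_X]
    rfl
  have heval : eval (∑ i, z i • of (m i)) = 0 := by
    rw [← evalP_toFormalPeriod, hS, evalP_aeval p (piRep_value p hpd hpi), hpoly]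
    exact aeval_real_legendre
  have hmem : (∑ i, z i • of (m i)) ∈ relations :=
    h1 (Fin 3) z a b c m hmd (fun i x _ => by rw [hmi i]) heval
  rw [← hpoly, ← hS]
  exact toFormalPeriod_eq_zero_of_mem hmem

/-- **`H₁ → 0280`**: the sector kernel implies the generator transfer `GpcLegendreLemniscatic`.
From `ψ(L) = 0`: `2·(⟦[g]⟧κ − ⟦[r₀']⟧) = ψ(L) + 2κ(⟦[g]⟧ − 2ε + κ) + (ϖ − 2⟦[r₀']⟧) = 0`, so
`2·([r₀] − [r₀'])` is a relation and hence `[r₀] − [r₀']` is (torsion-freeness §4c) — the place where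
"no division by integers" would have bitten, and does not. [folklore] -/
theorem gpcLegendre_of_h1 (h1 : LemniscaticSectorKernel) : GpcLegendreLemniscatic := by
  obtain ⟨p, hpd, hpi⟩ := exists_piRep
  have hL := aeval_formalPeriod_legendre_of_h1 h1 p hpd hpi
  have hg := toFormalPeriod_gRep
  have hp := toFormalPeriod_piRep p hpd hpi
  simp only [map_sub, map_mul, map_pow, MvPolynomial.aeval_X, map_ofNat] at hL
  simp only [Matrix.cons_val_zero, Matrix.cons_val_one, Matrix.head_cons, Matrix.cons_val_two,
    Matrix.tail_cons] at hL
  rw [gpcLegendre_iff]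
  have h2 : (2 : ℕ) • (of legendreRep - of arctanRep) ∈ relations := by
    rw [← toFormalPeriod_eq_zero_iff, map_nsmul, map_sub]
    have hprod : toFormalPeriod (of legendreRep) =
        toFormalPeriod (of gRep) * toFormalPeriod (of kRep) := by
      rw [toFormalPeriod_of_mul_of]; rfl
    rw [hprod]
    linear_combination hL + (2 * toFormalPeriod (of kRep)) * hg + hp
  exact mem_relations_of_nsmul_mem_relations two_ne_zero h2

/-- **Given Chudnovsky (8611), the rank-0 target IS the rank-5 crux**: `H₁ ↔ 0280`
(glue 8612, proved in the tree, and `gpcLegendre_of_h1`). [folklore] -/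
theorem h1_iff_gpcLegendre (hk : KEAlgIndependent) : LemniscaticSectorKernel ↔ GpcLegendreLemniscatic :=
  ⟨gpcLegendre_of_h1, lemniscaticSectorGlue_proof hk⟩

/-- **TRANSFER FORM, now only modulo 8611**: the crux says exactly that the two SINGLE identities
0280 (Legendre at `k² = 1/2`) and 0275 (`ζ(4) = 4ζ(3,1)`) inside the calculus imply Conjecture 1 for
ALL periods. [folklore] -/
theorem crux_iff_transfer_form' (hk : KEAlgIndependent) :
    SectorComplement ↔ (GpcLegendreLemniscatic → GpcZeta4Eq4zeta31 → KontsevichZagierPeriods) :=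
  crux_iff_transfer_form hk gpcLegendre_of_h1

/-- … and `H₂` is idle in the crux iff `0280 → 0275` (given 8611). [folklore] -/
theorem crux_iff_withoutH2_iff' (hk : KEAlgIndependent) :
    (SectorComplement ↔ WithoutH2) ↔ (GpcLegendreLemniscatic → GpcZeta4Eq4zeta31) := by
  rw [crux_iff_withoutH2_iff, h1_iff_gpcLegendre hk]

/-! ## §7 Near-misses / open questions (docstrings only)

* OPEN (= the summit): is `ker KZ.eval = KZ.relations`? Equivalently (this file) is `SectorComplement`
  true given `H₁ ∧ H₂`. No candidate separating invariant survives (see module docstring).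
* OPEN (cheap question for the planner, not for a prover): does `H₁ → H₂` hold by a ROUTE-LOCAL argument
  (both are kernel statements, but on disjoint families of representations: products of `K, E, π`
  monomials versus weight-4 simplex words)? If yes, `H₂` is idle in the crux (`crux_iff_withoutH2_of`).
  Nothing in the sector ring `ℤ[K, E, π]` evaluates to `ζ(4) − 4ζ(3,1)` except through `π⁴ = 90ζ(4)`,
  which is Euler's evaluation — itself an open crux elsewhere (CompiledSubstitutions), so we expect NO.
-/

end Summit.KontsevichZagierPeriods.KontsevichZagierPeriods.Cruxes.SectorComplement.Disproof
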